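import Summits.CriticalPhenomena.PercolationContinuityZ3.Theorems.PercAnnulusCrossingIICShortCrossings
import Literature.Probability.Percolation.AizenmanBurchardTortuosity
import HarnessLib

/-!
# The chemical distance of Kesten's planar IIC is SUPERLINEAR in probability — conditional on Aizenman–Burchard's tortuosity bound
# (lane RSW3, p1 gen 16)

builds on p205010 (kernel theorem, internal audit signed; external expert review pending) — NOT used in this file (`ℤ²` at `p_c = 1/2`).

Seat `prim-rsw3-p1` (gen 16); memo `run/shared/lean/prim/rsw3/P1-QM.md` §29.  Helper file for the crux `stmt-CriticalPhenomena-4575` chain; no sorries.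
The successor item of p1 gen 15 (unit HANDOFF 172): gen 15's `iicMeasure_real_chemical_le_le_criticalProbI` bounds `ν(D_N ≤ ℓ)` by the
`P_{p_c}`-probability of a SHORT CROSSING `S(n,N,ℓ)` of the annulus `Λ(N) ∖ Λ(n)`; Aizenman–Burchard's tortuosity theorem for planar critical
percolation says that such short crossings (of length `≤ u·n^s`, some `s > 1`) are unlikely, uniformly in the scale.  That published theorem is
the NAMED FACT `Literature.Probability.Percolation.AizenmanBurchard1999_shortCrossings_half` (lattice form of Duke Math. J. 99 (1999) Thm. 1.3 with
(1.6)(ii) and §7; `Literature/Probability/Percolation/AizenmanBurchardTortuosity.lean`, NOT proved in the tree); the IIC statement below is CONDITIONAL on it: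

* **`iicMeasure_real_chemical_le_superlinear_of_AB_Z2`** — ASSUMING it: for every measure `ν` with Kesten's IIC limit property at `p_c(ℤ²) = 1/2`
  there is `s > 1` such that for every `η > 0` there is `u > 0` with **`ν(D_{2n} ≤ u·n^s) ≤ η` for all large `n`** (`D_N` = chemical distance from
  the root to `Λ(N)ᶜ`): the geodesics of the planar IIC are superlinear, in probability.  (An a.s. exponent bound `α⁻ > 1` would need a SUMMABLE
  form of the fact — gen 15's `iicMeasure_chemical_exponent_ge_of_summable_shortCrossings_Z2`; the published statement is tightness only.)
References: M. Aizenman, A. Burchard, *Hölder regularity and dimension bounds for random curves*, Duke Math. J. 99 (1999) 419–453, Thm. 1.3,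
(1.6)(ii), §7 (2D bond percolation satisfies H2 via RSW + BK); H. Kesten, PTRF 73 (1986), §2; H. Kesten, Y. Zhang (1993) (tortuosity of the lowest crossing).
-/

noncomputable section

namespace Summit.CriticalPhenomena.PercolationContinuityZ3.Theorems.Crossing

open MeasureTheory Filter Topology Literature.Probability.Percolation Literature.Probability.LatticeModels
open Literature.Probability.Percolation.DCT16 Literature.Probability.Percolation.DKT20
open scoped Literature.Probability.Percolation ENNReal

/-- **THE GEODESICS OF KESTEN'S PLANAR IIC ARE SUPERLINEAR (in probability), CONDITIONAL ON AIZENMAN–BURCHARD**: assuming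
`AizenmanBurchard1999_shortCrossings_half`, for every measure `ν` with Kesten's IIC limit property at `p_c(ℤ²) = 1/2` there is `s > 1` such that
for every `η > 0` some `u > 0` satisfies `ν(D_{2n} ≤ ⌊u·n^s⌋) ≤ η` for all large `n`, where `D_N = dist_ω(0, Λ(N)ᶜ)` is the chemical distance of
the IIC from the root to the complement of `Λ(N)` (gen 15: `ν(D_N ≤ ℓ) ≤ C·P_{p_c}(short crossing)`). [cite: AizenmanBurchard1999, Thm. 1.3]
[cite: Kesten1986, §2] -/
theorem iicMeasure_real_chemical_le_superlinear_of_AB_Z2 (hAB : AizenmanBurchard1999_shortCrossings_half)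
    {ν : Measure (BondConfig (Site 2))} [IsProbabilityMeasure ν]
    (hν : ∀ (F : Finset (Sym2 (Site 2))) (E : Set (BondConfig (Site 2))), MeasurableSet E → DeterminedBy E ↑F →
      Tendsto (fun n : ℕ => (bondPercolation (zdGraph 2) (criticalProbI 2)).real (E ∩ siteToBoundary 2 n) /
        oneArmProb 2 (criticalProbI 2) n) atTop (𝓝 (ν.real E))) :
    ∃ s : ℝ, 1 < s ∧ ∀ η : ℝ, 0 < η → ∃ u : ℝ, 0 < u ∧ ∃ n₀ : ℕ, ∀ n : ℕ, n₀ ≤ n →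
      ν.real {ω | (⨅ v : {v : Site 2 // v ∉ box 2 (2 * n)}, (openGraph ω).edist (0 : Site 2) v.1) ≤ ⌊u * (n : ℝ) ^ s⌋₊} ≤ η := by
  obtain ⟨ϰ, hϰ, hA2⟩ := exists_setToSetQuasiMultAspectAt_two_of_criticalProbI_le
  obtain ⟨C, hC, hcmp⟩ := iicMeasure_real_chemical_le_le_criticalProbI (d := 2) le_rfl (by norm_num) (by norm_num) hϰ (hA2 _ le_rfl)
  have hpc : criticalProbI 2 = half := SubpolynomialBlocking.StubBlockProbTwoPos.criticalProbI_two_eq_half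
  obtain ⟨s, hs, hη⟩ := hAB
  refine ⟨s, hs, fun η hηpos => ?_⟩
  obtain ⟨u, hu, n₀, hn₀⟩ := hη (η / C) (div_pos hηpos hC)
  refine ⟨u, hu, max n₀ 2, fun n hn => ?_⟩
  have hn2 : 2 ≤ n := le_trans (le_max_right _ _) hn
  have h1 := hcmp ν hν n (2 * n) ⌊u * (n : ℝ) ^ s⌋₊ (by omega) (by omega) le_rfl
  have h2 := hn₀ n (le_trans (le_max_left _ _) hn)
  rw [← hpc] at h2
  calc _ ≤ C * (bondPercolation (zdGraph 2) (criticalProbI 2)).real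
        {ω : BondConfig (Site 2) | ∃ a ∈ innerBoundary (zdGraph 2) (box 2 (n + 1)), ∃ v ∈ innerBoundary (zdGraph 2) (box 2 (2 * n)),
          (openGraph (ω ∩ ((↑(box 2 (2 * n)) : Set (Site 2)) \ ↑(box 2 n)).sym2)).edist a v ≤ ⌊u * (n : ℝ) ^ s⌋₊} := h1
    _ ≤ C * (η / C) := mul_le_mul_of_nonneg_left h2 hC.le
    _ = η := by field_simp

end Summit.CriticalPhenomena.PercolationContinuityZ3.Theorems.Crossing

end
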